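import Literature.IUT.HodgeArakelov.RealifiedPrimeStripsFinsupp
import Literature.IUT.HodgeArakelov.KummerPrimeStripCategories

/-!
# [IUTchII] Def 4.9 (viii): the groupoid of `F^{⊩▶×μ}`-prime-strips and the functor `F^{⊩▶×μ} ↦ F^{⊢▶×μ}`

Owner file (abc-iut cell, layer L6; abc-iut-L6-t2), sequel to `KummerPrimeStripCategories.lean` over the
Fintype-free records of `RealifiedPrimeStripsFinsupp.lean`. S. Mochizuki, *Inter-universal Teichmüller theory II*,
kurims Dec-2020 manuscript, Def 4.9 (viii) p. 158: an `F^{⊩▶×μ}`-prime-strip is "a collection of data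
`*F^{⊩▶×μ} = (*C^⊩, Prime(*C^⊩) ⥲ V, *F^{⊢▶×μ}, {*ρ_v}_{v∈V})`" and ([IUTchI] Def 5.2 (iv)) "a morphism … is defined to
be an isomorphism between collections of data". Contents:

* `FVdashTriMuPrimeStripF.Hom S T` — a morphism: a bijection of the objects of `*C^⊩` respecting isomorphism
  classes and degrees and carrying pilot object to pilot object up to isomorphism (as in the frozen
  `FVdashTriMuIso`), TOGETHER WITH the `V`-indexed local isomorphisms of the `F^{⊢▶×μ}`-data as DATA
  (`LocalTriMuDatum.Iso`), so that forgetting to `F^{⊢▶×μ}` is a functor; (compatibility with the `ρ_v` is, as in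
  the frozen record, not carried — TODO when `O^▶` is made functorial in `LocalTriMuDatum.Iso`);
* `Groupoid (FVdashTriMuPrimeStripF P G X)` (identities/composites/inverses use that `Iso` on `*C^⊩` is an
  equivalence relation — the field `iso_equivalence` of the successor record);
* `FVdashTriMuPrimeStripF.toStripFunctor : FVdashTriMuPrimeStripF P G X ⥤ FTriMuPrimeStrip P G X` (the
  `StripFrame.FglxmToFvtxm` shape) and `Hom.toIsoF` (every morphism yields the Prop-level `FVdashTriMuIsoF`,
  hence `pilot_deg_eq`).

Claim key `Mochizuki2012` DISPUTED (D-0012): definitions + bookkeeping; nothing asserted.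
-/

namespace Literature.IUT.HodgeArakelov

open CategoryTheory

universe u v w

variable {V : Type u} {P : PlaceData V} {G : V → Type u} [∀ v, Group (G v)]
  {X : ∀ v, GroupTheoreticUnits.{u, w} (G v)}

namespace FVdashTriMuPrimeStripF

/-- **A morphism of `F^{⊩▶×μ}`-prime-strips** ([IUTchII] Def 4.9 (viii) p. 158; [IUTchI] Def 5.2 (iv) "an
isomorphism between collections of data"): a bijection of the objects of the global realified Frobenioids
respecting isomorphism classes and degrees, pilot object to pilot object (up to isomorphism), and a `V`-indexed
collection of isomorphisms of the local `F^{⊢▶×μ}`-data. [cite: Mochizuki2012, Def 4.9 (viii) p.158] -/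
structure Hom (S T : FVdashTriMuPrimeStripF.{u, v, w} P G X) : Type (max u v w) where
  /-- bijection on objects of `*C^⊩` -/
  objEquiv : S.realifiedF.Obj ≃ T.realifiedF.Obj
  /-- it respects isomorphism classes -/
  map_iso : ∀ a b, S.realifiedF.Iso a b ↔ T.realifiedF.Iso (objEquiv a) (objEquiv b)
  /-- it preserves arithmetic degrees -/
  deg_eq : ∀ a, T.realifiedF.deg (objEquiv a) = S.realifiedF.deg a
  /-- pilot object goes to pilot object, up to isomorphism -/
  map_pilot : T.realifiedF.Iso (objEquiv S.pilot) T.pilot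
  /-- the local `F^{⊢▶×μ}`-data are identified place by place (as DATA) -/
  locIso : ∀ v : V, LocalTriMuDatum.Iso (S.strip.localDatum v) (T.strip.localDatum v)

namespace Hom

variable {S T U : FVdashTriMuPrimeStripF.{u, v, w} P G X}

/-- A morphism is determined by its object bijection and its local isomorphisms. (bookkeeping). [cite: Mochizuki2012, Def 4.9 (viii) p.158] -/
theorem ext' {f g : Hom S T} (h₁ : f.objEquiv = g.objEquiv) (h₂ : f.locIso = g.locIso) : f = g := by
  cases f; cases g; cases h₁; cases h₂; rfl

/-- Identity morphism (uses reflexivity of `Iso` on `*C^⊩`). [cite: Mochizuki2012, Def 4.9 (viii) p.158] -/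
def id (S : FVdashTriMuPrimeStripF.{u, v, w} P G X) : Hom S S where
  objEquiv := Equiv.refl _
  map_iso _ _ := Iff.rfl
  deg_eq _ := rfl
  map_pilot := S.realifiedF.iso_equivalence.refl _
  locIso _ := LocalTriMuDatum.Iso.refl _

/-- Composite morphism (uses transitivity of `Iso` on `*C^⊩`). [cite: Mochizuki2012, Def 4.9 (viii) p.158] -/
def comp (f : Hom S T) (g : Hom T U) : Hom S U where
  objEquiv := f.objEquiv.trans g.objEquiv
  map_iso a b := (f.map_iso a b).trans (g.map_iso _ _)
  deg_eq a := by rw [Equiv.trans_apply, g.deg_eq, f.deg_eq]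
  map_pilot := by
    rw [Equiv.trans_apply]
    exact U.realifiedF.iso_equivalence.trans ((g.map_iso _ _).mp f.map_pilot) g.map_pilot
  locIso v := (f.locIso v).trans (g.locIso v)

/-- Inverse morphism (uses symmetry of `Iso` on `*C^⊩`). [cite: Mochizuki2012, Def 4.9 (viii) p.158] -/
def inv (f : Hom S T) : Hom T S where
  objEquiv := f.objEquiv.symm
  map_iso a b := by
    rw [f.map_iso, Equiv.apply_symm_apply, Equiv.apply_symm_apply]
  deg_eq b := by
    rw [← f.deg_eq, Equiv.apply_symm_apply]
  map_pilot := by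
    rw [f.map_iso, Equiv.apply_symm_apply]
    exact T.realifiedF.iso_equivalence.symm f.map_pilot
  locIso v := (f.locIso v).symm

/-- Every morphism yields the Prop-level isomorphism record `FVdashTriMuIsoF` (with local relation "an
isomorphism of local data exists"). [cite: Mochizuki2012, Def 4.9 (viii) p.158] -/
def toIsoF (f : Hom S T) :
    FVdashTriMuIsoF (fun v a b => Nonempty (LocalTriMuDatum.Iso (l := P.ell) (G := G v) (X := X v)
      (k := P.kind v) a b)) S T where
  objEquiv := f.objEquiv
  map_iso := f.map_iso
  deg_eq := f.deg_eq
  map_pilot := f.map_pilot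
  localIso v := ⟨f.locIso v⟩

/-- Hence a morphism identifies the (negative) degrees of the pilot objects. [cite: Mochizuki2012, Def 4.9 (viii) p.158] -/
theorem pilot_deg_eq (f : Hom S T) : S.realifiedF.deg S.pilot = T.realifiedF.deg T.pilot :=
  f.toIsoF.pilot_deg_eq

end Hom

/-- **IUTchII Def 4.9 (viii) p. 158: the groupoid of `F^{⊩▶×μ}`-prime-strips.** [cite: Mochizuki2012, Def 4.9 (viii) p.158] -/
instance instGroupoid : Groupoid (FVdashTriMuPrimeStripF.{u, v, w} P G X) where
  Hom := Hom
  id := Hom.id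
  comp := Hom.comp
  id_comp f := Hom.ext' (Equiv.ext fun _ => rfl) (funext fun v => LocalTriMuDatum.Iso.refl_trans (f.locIso v))
  comp_id f := Hom.ext' (Equiv.ext fun _ => rfl) (funext fun v => LocalTriMuDatum.Iso.trans_refl (f.locIso v))
  assoc f g h := Hom.ext' (Equiv.ext fun _ => rfl)
    (funext fun v => LocalTriMuDatum.Iso.trans_assoc (f.locIso v) (g.locIso v) (h.locIso v))
  inv := Hom.inv
  inv_comp f := Hom.ext' (Equiv.ext fun x => f.objEquiv.apply_symm_apply x)
    (funext fun v => LocalTriMuDatum.Iso.symm_trans (f.locIso v))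
  comp_inv f := Hom.ext' (Equiv.ext fun x => f.objEquiv.symm_apply_apply x)
    (funext fun v => LocalTriMuDatum.Iso.trans_symm (f.locIso v))

/-- **Forgetting to the `F^{⊢▶×μ}`-prime-strip** `*F^{⊩▶×μ} ↦ *F^{⊢▶×μ}` ([IUTchII] Def 4.9 (viii) p. 158), as a
functor (the `StripFrame.FglxmToFvtxm` shape). [cite: Mochizuki2012, Def 4.9 (viii) p.158] -/
def toStripFunctor : FVdashTriMuPrimeStripF.{u, v, w} P G X ⥤ FTriMuPrimeStrip.{u, v, w} P G X where
  obj S := S.strip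
  map f := f.locIso
  map_id _ := rfl
  map_comp _ _ := rfl

/-- On objects it is the underlying strip. [cite: Mochizuki2012, Def 4.9 (viii) p.158] -/
@[simp] theorem toStripFunctor_obj (S : FVdashTriMuPrimeStripF.{u, v, w} P G X) : toStripFunctor.obj S = S.strip := rfl

/-- On morphisms it is the local part. [cite: Mochizuki2012, Def 4.9 (viii) p.158] -/
@[simp] theorem toStripFunctor_map {S T : FVdashTriMuPrimeStripF.{u, v, w} P G X} (f : S ⟶ T) :
    toStripFunctor.map f = f.locIso := rfl

/-- KIT-RULE connectedness for `F^{⊩▶×μ}`-prime-strips ("isomorphic to `‡F^{⊩▶×μ}`", Def 4.9 (viii); the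
`StripFrame.iso_nonempty_Fglxm` shape). [cite: Mochizuki2012, Def 4.9 (viii) p.158] -/
theorem iso_nonempty_of_model (M : FVdashTriMuPrimeStripF.{u, v, w} P G X)
    (h : ∀ S : FVdashTriMuPrimeStripF.{u, v, w} P G X, Nonempty (S ≅ M))
    (S T : FVdashTriMuPrimeStripF.{u, v, w} P G X) : Nonempty (S ≅ T) := by
  obtain ⟨e⟩ := h S
  obtain ⟨e'⟩ := h T
  exact ⟨e ≪≫ e'.symm⟩

end FVdashTriMuPrimeStripF

end Literature.IUT.HodgeArakelov
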